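import Literature.NumberTheory.EllipticCurves.HeegnerPointsOfConductor
import Mathlib.Algebra.BigOperators.Intervals
import HarnessLib

/-!
# T1 JET (cell `bsd-jet`), road K, completion-layer gap `htr` — FIRST BRICK: under a map on which
# `σ_ℓ` acts trivially (reduction modulo a prime where `σ_ℓ` is inertial), Kolyvagin's derivative
# `D_ℓ = Σ_{i=1}^{ℓ} i σ_ℓ^i` becomes multiplication by `ℓ(ℓ+1)/2`, a multiple of `p^k` for `p` odd,
# `p^k ∣ ℓ + 1`

HONEST FRAMING (programme file §HONESTY, verbatim): «no tranche here proves BSD; ARM L moves the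
LITERAL column of an r ≤ 1 census into the kernel-proved-modulo-named-print column.» THEOREMS ONLY
(seat `bsd-jet-pv-2`, session g4; `--supports stmt-BirchSwinnertonDyer-14418`, helper); 0 classes
move; pure algebra, nothing is `p`-specific beyond `p` odd. WHAT THIS IS. The transverse-condition gap
`htr` of the H63 line (`JET.tamagawaExponent_le_mInfty_of_localInputs`, p508802: Kolyvagin's class
`c_k(c)` lies in `transverseKer ℓ` for `ℓ ∣ c`) is Howard 2004, Lemma 2.7.3 (arXiv numbering), whose
arithmetic core is the one-line computation *"Since `σ_ℓ` acts trivially … `(D_ℓ c)(Frob_λ) =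
Σ_{i=1}^{ℓ} i c(Frob_λ) = ℓ(ℓ+1)/2 · c(Frob_λ) = 0`"* — `σ_ℓ` lies in the inertia group of the
totally ramified `λ`, which acts trivially on the reduction (tree:
`RingClassTower.exists_mem_inertia_smul_eq_of_mem_ringClassGalOver`, `geomReduction_smul_of_mem_inertia`),
and `p^k ∣ ℓ + 1` with `p` odd kills `ℓ(ℓ+1)/2` modulo `p^k`. This file proves that core for the
tree's operator `KolyvaginOperator.derivOp` and ANY additive map `red` with `red ∘ σ = red`:
`map_derivOp_of_map_apply_eq` (`red (D_ℓ y) = (ℓ(ℓ+1)/2) • red y`), `pow_dvd_choose_two`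
(`p^k ∣ ℓ(ℓ+1)/2`), `exists_map_derivOp_eq_pow_smul` (`red (D_ℓ y) = p^k • b`). The remaining
(infrastructure) steps of `htr` — identifying `loc_{w'} res_{K[ℓ]} c_k(c) = 0` with the
`p^k`-divisibility of the reduction of `P_c` at a prime over `w'` — are sheet PV2-J6-KERNEL
ADDENDUM-4 §3. References: [cite: Howard2004HeegnerKolyvagin, Lemma 2.7.3 (arXiv:1202.6340 p. 13)]
[cite: GrossLMS1991, §3 (3.5) (D_ℓ), Prop. 3.7] [cite: Jetchev2008, Prop. 4.6 (p. 820)].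
-/

set_option autoImplicit false

open Finset Literature.NumberTheory.EllipticCurves

namespace Summit.BirchSwinnertonDyer.Rank1Residual.JET

section Algebra

variable {G : Type*} [Monoid G] {A : Type*} [AddCommMonoid A] {B : Type*} [AddCommMonoid B]
  (ρ : G →* AddMonoid.End A) (red : A →+ B)

/-- If `red ∘ σ = red` then `red ∘ σ^i = red`. [folklore] -/
theorem map_apply_pow_eq_of_map_apply_eq {σ : G} (hσ : ∀ a, red (ρ σ a) = red a) (i : ℕ) (a : A) :
    red (ρ (σ ^ i) a) = red a := by
  induction i generalizing a with
  | zero => rw [pow_zero, map_one]; rfl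
  | succ i ih =>
    rw [pow_succ, map_mul]
    change red (ρ (σ ^ i) (ρ σ a)) = red a
    rw [ih, hσ]

/-- **Kolyvagin's derivative under a `σ_ℓ`-invariant map**: if `red (σ a) = red a` for all `a`
(`σ = σ_ℓ` inertial at the prime of reduction), then `red (D_ℓ y) = (Σ_{i=0}^{ℓ} i) • red y =
(ℓ(ℓ+1)/2) • red y` — Howard's *"`(D_ℓ c)(Frob_λ) = Σ i c(Frob_λ) = ℓ(ℓ+1)/2 · c(Frob_λ)`"*.
[cite: Howard2004HeegnerKolyvagin, Lemma 2.7.3 (proof)] [cite: GrossLMS1991, §3 (3.5)] -/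
theorem map_derivOp_of_map_apply_eq {σ : G} (hσ : ∀ a, red (ρ σ a) = red a) (ℓ : ℕ) (y : A) :
    red (KolyvaginOperator.derivOp ρ σ ℓ y) = (ℓ * (ℓ + 1) / 2) • red y := by
  unfold KolyvaginOperator.derivOp
  rw [map_sum]
  simp_rw [map_nsmul, map_apply_pow_eq_of_map_apply_eq ρ red hσ]
  rw [← Finset.sum_smul]
  congr 1
  have h := Finset.sum_range_id_mul_two (ℓ + 1)
  rw [Nat.add_sub_cancel] at h
  rw [mul_comm ℓ, ← h, Nat.mul_div_cancel _ two_pos]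

/-- For `p` odd and `p^k ∣ ℓ + 1`: `p^k ∣ ℓ(ℓ+1)/2`. [folklore] -/
theorem pow_dvd_choose_two {p k ℓ : ℕ} (hp : p.Prime) (hp2 : p ≠ 2) (h : p ^ k ∣ ℓ + 1) :
    p ^ k ∣ ℓ * (ℓ + 1) / 2 := by
  have hcop : Nat.Coprime (p ^ k) 2 :=
    Nat.Coprime.pow_left k ((Nat.coprime_primes hp Nat.prime_two).mpr hp2)
  have h2 : 2 ∣ ℓ * (ℓ + 1) := (Nat.even_mul_succ_self ℓ).two_dvd
  refine (hcop.dvd_mul_right).mp ?_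
  rw [Nat.div_mul_cancel h2]
  exact h.mul_left ℓ

/-- **`red (D_ℓ y)` is `p^k`-divisible** (in the image of `red`) when `red ∘ σ_ℓ = red`, `p` odd and
`p^k ∣ ℓ + 1` (the Zhang–Kolyvagin condition `k ≤ M(ℓ)`): the reduction half of the transverse
condition `htr` at a prime of `c`. [cite: Howard2004HeegnerKolyvagin, Lemma 2.7.3]
[cite: Jetchev2008, Prop. 4.6 (p. 820)] -/
theorem exists_map_derivOp_eq_pow_smul {σ : G} (hσ : ∀ a, red (ρ σ a) = red a) {p k ℓ : ℕ}
    (hp : p.Prime) (hp2 : p ≠ 2) (h : p ^ k ∣ ℓ + 1) (y : A) :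
    ∃ b : B, red (KolyvaginOperator.derivOp ρ σ ℓ y) = (p ^ k) • b ∧ ∃ a : A, b = red a := by
  obtain ⟨q, hq⟩ := pow_dvd_choose_two hp hp2 h
  refine ⟨q • red y, ?_, q • y, (map_nsmul red q y).symm⟩
  rw [map_derivOp_of_map_apply_eq ρ red hσ, hq, mul_nsmul']

end Algebra

end Summit.BirchSwinnertonDyer.Rank1Residual.JET
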